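import Literature.NumberTheory.Automorphic.RankOneAssembly
import Literature.NumberTheory.Automorphic.BorelParabolic
import HarnessLib

/-!
# The coroots of a connected reductive group: `exists_corootMap` from three structure facts

Trunk T-AUTOMORPHIC (G25 AutomorphicL); proof companion of `ReductiveDualRootDatum.lean`
(namespace `Literature.NumberTheory.Automorphic`), whose named fact `exists_corootMap` — Springer,
*Linear Algebraic Groups*, 2nd ed., 7.4.3 with 7.3.5 (i), 8.1.1 (i), 8.1.4 (i): *a connected
reductive `G` with maximal torus `T` over an algebraically closed field has a coroot map
`α ↦ α^∨`, every `(u_α, u_{-α}, α^∨)` being realised by an algebraic homomorphism `SL₂ → G`, and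
axiom (RD 2) holds* — is reduced there to the named fact `exists_sl2Realization` (8.1.4 (i))
by the proved assembly `exists_corootMap_of_sl2Realization` (Weyl elements `n_α`, uniqueness of
the coroot). The tree has since proved every further step of Springer's route to 8.1.4 (i):

* `exists_sl2Realization_of_facts` (`ReductiveDualRankOne.lean`; passage to `G_α = Z_G((Ker α)°)`,
  8.1.4 (i) proof, first sentence),
* `exists_sl2Realization_of_central_of_relations` (`ReductiveDualRelations.lean`; the
  homomorphism `SL₂ → G_α` from the relations (19), (20) of 7.2.4, and its algebraicity),
* `exists_rankOneRelations_of_central_of_bruhat` (`ReductiveDualBruhat.lean`; (19), (20) from the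
  Bruhat decomposition 7.2.2 (i)),
* `bruhat_rankOne_of_central_holds_of` (`RankOneAssembly.lean`; 7.2.2 (i) on `k`-points through
  `G/B ≅ ℙ¹`, 7.1.5),

together with the discharges `isBorelIn_conj_holds` (6.2.7 (iii), `BorelConjugacy.lean`),
`isMaximalTorusIn_conj_of_isSolvable_holds` (6.4.1, `SolvableGroupTori.lean`) and
`isClosed_orbitCone_of_borel_le_lineStabilizer_holds` (6.2.7 (ii), `BorelParabolic.lean`).
This file records the resulting one-line compositions, so that the discharge of
`exists_corootMap` (and of `exists_sl2Realization`) is mechanical once the three remaining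
structure-theoretic named facts land:

* `isConnectedReductive_centralizer_torus` — Springer **7.6.4 (i)** (`Z_G(S)` is connected
  reductive for a subtorus `S` of a connected reductive `G`);
* `centralizer_eq_of_isMaximalTorusIn` — Springer **7.6.4 (ii)** (`Z_G(T) = T`);
* `exists_rootHom_sup_isBorelIn_of_central` — Springer **7.3.3 (ii)** in semisimple rank one
  (`T · U_α` is a Borel subgroup for some root homomorphism of `±α`).

Proved here (pure compositions, no new facts):

* `exists_sl2Realization_of_structureFacts` — 7.6.4 (i), 7.6.4 (ii), 7.3.3 (ii) ⟹
  `exists_sl2Realization` (8.1.4 (i));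
* `exists_corootMap_of_structureFacts` — 7.6.4 (i), 7.6.4 (ii), 7.3.3 (ii) ⟹ `exists_corootMap`
  (7.4.3: coroots, `SL₂`-realisations, (RD 2)).

## References

* [SpringerLAG1998] T. A. Springer, *Linear Algebraic Groups*, 2nd ed., Progress in Mathematics
  9, Birkhäuser (1998): 6.2.7, 6.4.1, 7.1.4, 7.2.2 (i), 7.2.4, 7.3.3 (ii), 7.3.5 (i), 7.4.3,
  7.6.4, 8.1.1 (i), 8.1.4 (i) (pp. 124–125, 131–132 of the printed text for 7.4.3, 8.1.4).
-/

open scoped MatrixGroups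

namespace Literature.NumberTheory.Automorphic

variable {k : Type*} [Field k] {n : Type*} [Fintype n] [DecidableEq n] {G T : Subgroup (GL n k)}

/-- **Springer 8.1.4 (i) from 7.6.4 (i), 7.6.4 (ii) and 7.3.3 (ii).** Every root of a connected
reductive group relative to a maximal torus, over an algebraically closed field, admits an
`SL₂`-realisation (`exists_sl2Realization`), granted the named facts
`isConnectedReductive_centralizer_torus` (7.6.4 (i)), `centralizer_eq_of_isMaximalTorusIn`
(7.6.4 (ii)) and `exists_rootHom_sup_isBorelIn_of_central` (7.3.3 (ii)). Composition of the
printed route: pass to `G_α` (`exists_sl2Realization_of_facts`), where the Bruhat decomposition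
7.2.2 (i) (`bruhat_rankOne_of_central_holds_of`, fed by the discharged 6.2.7 (ii)–(iii)) yields the
relations (19), (20) of 7.2.4 (`exists_rankOneRelations_of_central_of_bruhat`; the input 7.1.4 with
6.4.12, `atMostTwo_isBorelIn_of_central`, being derived from 7.6.4 (ii) by
`atMostTwo_isBorelIn_of_central_of_facts`) and hence the homomorphism `SL₂ → G_α`
(`exists_sl2Realization_of_central_of_relations`).
[cite: SpringerLAG1998, 8.1.4 (i) with 7.2.2 (i), 7.2.4, 7.3.3 (ii), 7.6.4] -/
theorem exists_sl2Realization_of_structureFacts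
    (hA : isConnectedReductive_centralizer_torus (k := k) (n := n))
    (hF₃ : centralizer_eq_of_isMaximalTorusIn (k := k) (n := n))
    (hC₂ : exists_rootHom_sup_isBorelIn_of_central (k := k) (n := n)) :
    exists_sl2Realization (G := G) (T := T) :=
  have hC₁ : atMostTwo_isBorelIn_of_central (k := k) (n := n) :=
    atMostTwo_isBorelIn_of_central_of_facts isBorelIn_conj_holds
      isMaximalTorusIn_conj_of_isSolvable_holds hF₃
  exists_sl2Realization_of_facts hA
    (exists_sl2Realization_of_central_of_relations
      (exists_rankOneRelations_of_central_of_bruhat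
        (bruhat_rankOne_of_central_holds_of isBorelIn_conj_holds hF₃ hC₂
          isClosed_orbitCone_of_borel_le_lineStabilizer_holds)
        isBorelIn_conj_holds hC₁ hC₂))

/-- **Springer 7.4.3 (coroots, `SL₂`-realisations, (RD 2)) from 7.6.4 (i), 7.6.4 (ii) and
7.3.3 (ii).** The named fact `exists_corootMap` — for `G` connected reductive with maximal torus
`T` over an algebraically closed field there is a coroot map `α ↦ α^∨` on `R(G, T)` such that
every `(u_α, u_{-α}, α^∨)` is realised by an algebraic homomorphism `SL₂ → G` (8.1.4 (i), (22))
and `s_α(R) ⊆ R`, `s_α^∨(R^∨) ⊆ R^∨` ((RD 2), "see 7.1.8 (i) and 7.1.4") — follows from the three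
structure-theoretic named facts `isConnectedReductive_centralizer_torus` (7.6.4 (i)),
`centralizer_eq_of_isMaximalTorusIn` (7.6.4 (ii)) and `exists_rootHom_sup_isBorelIn_of_central`
(7.3.3 (ii)): `exists_sl2Realization_of_structureFacts` followed by the proved assembly
`exists_corootMap_of_sl2Realization` (the Weyl elements `n_α` of 8.1.4 and the uniqueness of the
coroot, 7.1.8). [cite: SpringerLAG1998, 7.4.3 with 7.3.5 (i), 8.1.1 (i), 8.1.4 (i)] -/
theorem exists_corootMap_of_structureFacts
    (hA : isConnectedReductive_centralizer_torus (k := k) (n := n))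
    (hF₃ : centralizer_eq_of_isMaximalTorusIn (k := k) (n := n))
    (hC₂ : exists_rootHom_sup_isBorelIn_of_central (k := k) (n := n)) :
    exists_corootMap (G := G) (T := T) :=
  exists_corootMap_of_sl2Realization (exists_sl2Realization_of_structureFacts hA hF₃ hC₂)

end Literature.NumberTheory.Automorphic
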